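import Summits.ValiantsHypothesis.ValiantsHypothesis.Theorems.LacunarySymmetroidMatrixDescartesDoorA26WallBubblingMixGram

/-!
# Wall bubbling for `DoorA26` — TWO WEYL PAIRS: SCALAR CORES OF THE REPAIRED THREE-SCALE RULE `MixThree26'`

HONEST FRAMING.  Obligation (W) `stub_weylFaces` of `Cruxes/DoorA26/Lines/wall_bubbling.lean` (crux `DoorA26`, stmt-ValiantsHypothesis-19979; OPEN,
typed, never asserted); W1 seat val-sym-door-p2 g14; second of three files towards `MixThree26'` (rev 9 of
`Cruxes/DoorA26/Lines/wall_bubbling_ConfluentDoor.lean`: symmetric letters, `δ0 0 ≠ δ0 1`).  Pure real-inequality cores, no matrices: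

* `pureClass_suppressed` — at a later scale `S`, a mixed degree-1 member alive and the three entries of the pure class `2δ₀` dominated force
  `κ|g₅₅|, κ|g₀₅|, κ|g₀₀| ≤ 6Φ⁶·ε·μ₁` with `ε = E₁/E₀ = e^{(δ₁−δ₀)S}` (the weight separation) and `Φ` any common bound for
  `1 + |Λ| + |Λ'| + e + e' + e⁻¹ + e'⁻¹` (mirror statement for the class `2δ₁` by relabelling);
* `mixThree_core_same` — the upstream-alive degree-1 member alive AGAIN at a later scale forces `κeκ₁²μ₁² ≤ |Λ|(κe + |Λ|)·|D|`
  (`D = g₀₁g₅₄ − g₀₄g₅₁`, Möbius identity `A·g₀₄ − X·g₀₁ = −Λ·D`);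
* `mixThree_core_cross` — the OTHER degree-1 member alive at both later scales forces `κ₁²κ₂κ₃μ₁²·e₂e'₂e'₃ < |Λ'₃−Λ'₂|·|D|·(e₂+|Λ₂|)(e₃+|Λ₃|)`
  (two-scale Möbius identity `A'₂Y₃ − A'₃Y₂ = (Λ'₃−Λ'₂)·D` + W2's `eventually_dslope_exp_gt` in the form `|Λ_L| > e_L/κ₃ + 1/κ₂ + 1`);
* `mixThree_kill_same`, `mixThree_kill_cross` — with the Lorentz–Gram bound `κ₃D² ≤ 120Φ⁶εμ₁⁴` (W1 `mixedBlock_det_sq_le`) these are absurd once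
  `122880·Φ¹⁸·ε < κ₁⁴κ₂²κ₃³` — which holds eventually because `ε = e^{−|δ₀−δ₁|S₃}` beats every sub-exponential `Φ`.

Registers unchanged; (W), `MixThree26'`, `DoorA26` 19979, 18050 OPEN; nothing on VP ≠ VNP.  Def-free.  `--supports stmt-ValiantsHypothesis-19979 --as helper`.
-/

-- `Summit.ValiantsHypothesis.ValiantsHypothesis.…` repeats a component by the D-0017 layout
-- (single-conjunct summit), which the `dupNamespace` linter flags; the name is mandated.
set_option linter.dupNamespace false

namespace Summit.ValiantsHypothesis.ValiantsHypothesis.Theorems.LacunarySymmetroidMatrixDescartes.WallBubbling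

open Finset Filter Topology
open scoped BigOperators

/-! ## 1. Suppression of the dominant pure class -/

/-- **SUPPRESSION OF A PURE CLASS BY THE WEIGHT SEPARATION.**  At a later scale with weights `E₀ = e^{δ₀S}`, `E₁ = ε·E₀`: if a mixed degree-1
member is alive at level `κ` (`κμ_S ≤ |G₀₄|` or `≤ |G₅₁|`) and the three class-`2δ₀` entries `G₅₅ = E₀²e²g₅₅`, `G₀₅ = E₀²e(g₀₅ + Λg₅₅)`,
`G₀₀ = E₀²(g₀₀ + 2Λg₀₅ + Λ²g₅₅)` are dominated by `μ_S`, then `κ|g₅₅|, κ|g₀₅|, κ|g₀₀| ≤ 6Φ⁶εμ₁`. [this work] -/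
theorem pureClass_suppressed {κ μS μ₁ E₀ ε e e' Λ Λ' g₀₄ g₅₄ g₅₁ g₅₅ g₀₅ g₀₀ Φ : ℝ}
    (hκ : 0 < κ) (hμ₁ : 0 ≤ μ₁) (hE₀ : 0 < E₀) (hε : 0 < ε) (he : 0 < e) (he' : 0 < e')
    (h04 : |g₀₄| ≤ μ₁) (h54 : |g₅₄| ≤ μ₁) (h51 : |g₅₁| ≤ μ₁)
    (halive : κ * μS ≤ E₀ * (ε * E₀) * e' * |g₀₄ + Λ * g₅₄| ∨ κ * μS ≤ E₀ * (ε * E₀) * e * |g₅₁ + Λ' * g₅₄|)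
    (hd55 : E₀ * E₀ * (e * e) * |g₅₅| ≤ μS) (hd05 : E₀ * E₀ * e * |g₀₅ + Λ * g₅₅| ≤ μS)
    (hd00 : E₀ * E₀ * |g₀₀ + 2 * Λ * g₀₅ + Λ * Λ * g₅₅| ≤ μS)
    (hΦ : 1 + |Λ| + |Λ'| + e + e' + e⁻¹ + e'⁻¹ ≤ Φ) :
    κ * |g₅₅| ≤ 12 * Φ ^ 6 * ε * μ₁ ∧ κ * |g₀₅| ≤ 12 * Φ ^ 6 * ε * μ₁ ∧ κ * |g₀₀| ≤ 12 * Φ ^ 6 * ε * μ₁ := by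
  have hΛ0 : 0 ≤ |Λ| := abs_nonneg _
  have hΛ'0 : 0 ≤ |Λ'| := abs_nonneg _
  have hei : 0 < e⁻¹ := inv_pos.mpr he
  have hei' : 0 < e'⁻¹ := inv_pos.mpr he'
  have hΦ1 : 1 ≤ Φ := by linarith
  have hΦpos : 0 < Φ := lt_of_lt_of_le one_pos hΦ1
  have hΛΦ : |Λ| ≤ Φ := by linarith
  have heΦ : e ≤ Φ := by linarith
  have he'Φ : e' ≤ Φ := by linarith
  have heiΦ : e⁻¹ ≤ Φ := by linarith
  -- the size `R = e'(1+|Λ|) + e(1+|Λ'|)` of the alive mixed entry, `R ≤ 2Φ²`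
  set R : ℝ := e' * (1 + |Λ|) + e * (1 + |Λ'|) with hR
  have hR0 : 0 ≤ R := by positivity
  have hRΦ : R ≤ 2 * Φ ^ 2 := by
    have t1 : e' * (1 + |Λ|) ≤ Φ * Φ := mul_le_mul he'Φ (by linarith) (by positivity) hΦpos.le
    have t2 : e * (1 + |Λ'|) ≤ Φ * Φ := mul_le_mul heΦ (by linarith) (by positivity) hΦpos.le
    rw [hR, pow_two]; linarith
  -- `κ μS ≤ E₀²·ε·μ₁·R`
  have hX : |g₀₄ + Λ * g₅₄| ≤ μ₁ * (1 + |Λ|) := by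
    have t := abs_add_le g₀₄ (Λ * g₅₄); rw [abs_mul] at t
    have t2 := mul_le_mul_of_nonneg_left h54 hΛ0
    linarith
  have hY : |g₅₁ + Λ' * g₅₄| ≤ μ₁ * (1 + |Λ'|) := by
    have t := abs_add_le g₅₁ (Λ' * g₅₄); rw [abs_mul] at t
    have t2 := mul_le_mul_of_nonneg_left h54 hΛ'0
    linarith
  have hC0 : 0 ≤ E₀ * E₀ * ε * μ₁ := by positivity
  have hμS : κ * μS ≤ E₀ * E₀ * ε * μ₁ * R := by
    rcases halive with h | h
    · have s1 : E₀ * (ε * E₀) * e' * |g₀₄ + Λ * g₅₄| ≤ E₀ * (ε * E₀) * e' * (μ₁ * (1 + |Λ|)) :=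
        mul_le_mul_of_nonneg_left hX (by positivity)
      have s2 : (E₀ * E₀ * ε * μ₁) * (e' * (1 + |Λ|)) ≤ (E₀ * E₀ * ε * μ₁) * R :=
        mul_le_mul_of_nonneg_left (by rw [hR]; nlinarith) hC0
      have s3 : E₀ * (ε * E₀) * e' * (μ₁ * (1 + |Λ|)) = (E₀ * E₀ * ε * μ₁) * (e' * (1 + |Λ|)) := by ring
      linarith
    · have s1 : E₀ * (ε * E₀) * e * |g₅₁ + Λ' * g₅₄| ≤ E₀ * (ε * E₀) * e * (μ₁ * (1 + |Λ'|)) :=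
        mul_le_mul_of_nonneg_left hY (by positivity)
      have s2 : (E₀ * E₀ * ε * μ₁) * (e * (1 + |Λ'|)) ≤ (E₀ * E₀ * ε * μ₁) * R :=
        mul_le_mul_of_nonneg_left (by rw [hR]; nlinarith) hC0
      have s3 : E₀ * (ε * E₀) * e * (μ₁ * (1 + |Λ'|)) = (E₀ * E₀ * ε * μ₁) * (e * (1 + |Λ'|)) := by ring
      linarith
  have hE2 : 0 < E₀ * E₀ := mul_pos hE₀ hE₀
  -- (1) `κ e² |g₅₅| ≤ ε μ₁ R`
  have s55 : κ * (e * e) * |g₅₅| ≤ ε * μ₁ * R := by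
    have t : κ * (E₀ * E₀ * (e * e) * |g₅₅|) ≤ E₀ * E₀ * ε * μ₁ * R := le_trans (mul_le_mul_of_nonneg_left hd55 hκ.le) hμS
    have t' : (E₀ * E₀) * (κ * (e * e) * |g₅₅|) ≤ (E₀ * E₀) * (ε * μ₁ * R) := by linarith
    exact le_of_mul_le_mul_left t' hE2
  -- (2) `κ e |g₀₅ + Λ g₅₅| ≤ ε μ₁ R`
  have s05 : κ * e * |g₀₅ + Λ * g₅₅| ≤ ε * μ₁ * R := by
    have t : κ * (E₀ * E₀ * e * |g₀₅ + Λ * g₅₅|) ≤ E₀ * E₀ * ε * μ₁ * R := le_trans (mul_le_mul_of_nonneg_left hd05 hκ.le) hμS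
    have t' : (E₀ * E₀) * (κ * e * |g₀₅ + Λ * g₅₅|) ≤ (E₀ * E₀) * (ε * μ₁ * R) := by linarith
    exact le_of_mul_le_mul_left t' hE2
  -- (3) `κ |g₀₀ + 2Λ g₀₅ + Λ² g₅₅| ≤ ε μ₁ R`
  have s00 : κ * |g₀₀ + 2 * Λ * g₀₅ + Λ * Λ * g₅₅| ≤ ε * μ₁ * R := by
    have t : κ * (E₀ * E₀ * |g₀₀ + 2 * Λ * g₀₅ + Λ * Λ * g₅₅|) ≤ E₀ * E₀ * ε * μ₁ * R :=
      le_trans (mul_le_mul_of_nonneg_left hd00 hκ.le) hμS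
    have t' : (E₀ * E₀) * (κ * |g₀₀ + 2 * Λ * g₀₅ + Λ * Λ * g₅₅|) ≤ (E₀ * E₀) * (ε * μ₁ * R) := by linarith
    exact le_of_mul_le_mul_left t' hE2
  -- unpack with `e⁻¹ ≤ Φ`
  have hee : e * e⁻¹ = 1 := mul_inv_cancel₀ he.ne'
  have hee2 : (e * e) * (e⁻¹ * e⁻¹) = 1 := by
    rw [show (e * e) * (e⁻¹ * e⁻¹) = (e * e⁻¹) * (e * e⁻¹) by ring, hee, one_mul]
  have P0 : 0 ≤ ε * μ₁ * R := by positivity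
  have g55b : κ * |g₅₅| ≤ ε * μ₁ * R * Φ ^ 2 := by
    have t : κ * |g₅₅| = (κ * (e * e) * |g₅₅|) * (e⁻¹ * e⁻¹) := by
      rw [show (κ * (e * e) * |g₅₅|) * (e⁻¹ * e⁻¹) = κ * |g₅₅| * ((e * e) * (e⁻¹ * e⁻¹)) by ring, hee2, mul_one]
    rw [t]
    have : e⁻¹ * e⁻¹ ≤ Φ ^ 2 := by rw [pow_two]; exact mul_le_mul heiΦ heiΦ hei.le hΦpos.le
    calc κ * (e * e) * |g₅₅| * (e⁻¹ * e⁻¹) ≤ (ε * μ₁ * R) * (e⁻¹ * e⁻¹) := mul_le_mul_of_nonneg_right s55 (by positivity)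
      _ ≤ (ε * μ₁ * R) * Φ ^ 2 := mul_le_mul_of_nonneg_left this P0
  have g05b : κ * |g₀₅| ≤ ε * μ₁ * R * (Φ + Φ ^ 3) := by
    have t1 : κ * |g₀₅ + Λ * g₅₅| ≤ ε * μ₁ * R * Φ := by
      have t : κ * |g₀₅ + Λ * g₅₅| = (κ * e * |g₀₅ + Λ * g₅₅|) * e⁻¹ := by
        rw [show (κ * e * |g₀₅ + Λ * g₅₅|) * e⁻¹ = κ * |g₀₅ + Λ * g₅₅| * (e * e⁻¹) by ring, hee, mul_one]
      rw [t]
      calc (κ * e * |g₀₅ + Λ * g₅₅|) * e⁻¹ ≤ (ε * μ₁ * R) * e⁻¹ := mul_le_mul_of_nonneg_right s05 hei.le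
        _ ≤ (ε * μ₁ * R) * Φ := mul_le_mul_of_nonneg_left heiΦ P0
    have t2 : |g₀₅| ≤ |g₀₅ + Λ * g₅₅| + |Λ| * |g₅₅| := by
      have := abs_sub_abs_le_abs_sub g₀₅ (g₀₅ + Λ * g₅₅)
      rw [show g₀₅ - (g₀₅ + Λ * g₅₅) = -(Λ * g₅₅) by ring, abs_neg, abs_mul] at this
      linarith
    have t3 : |Λ| * (κ * |g₅₅|) ≤ Φ * (ε * μ₁ * R * Φ ^ 2) := mul_le_mul hΛΦ g55b (by positivity) hΦpos.le
    have t4 := mul_le_mul_of_nonneg_left t2 hκ.le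
    have e3 : Φ * (ε * μ₁ * R * Φ ^ 2) = ε * μ₁ * R * Φ ^ 3 := by ring
    linarith
  have g00b : κ * |g₀₀| ≤ ε * μ₁ * R * (6 * Φ ^ 4) := by
    have t2 : |g₀₀| ≤ |g₀₀ + 2 * Λ * g₀₅ + Λ * Λ * g₅₅| + 2 * |Λ| * |g₀₅| + |Λ| * |Λ| * |g₅₅| := by
      have := abs_sub_abs_le_abs_sub g₀₀ (g₀₀ + 2 * Λ * g₀₅ + Λ * Λ * g₅₅)
      rw [show g₀₀ - (g₀₀ + 2 * Λ * g₀₅ + Λ * Λ * g₅₅) = -(2 * Λ * g₀₅ + Λ * Λ * g₅₅) by ring, abs_neg] at this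
      have u := abs_add_le (2 * Λ * g₀₅) (Λ * Λ * g₅₅)
      rw [abs_mul, abs_mul, abs_two, abs_mul, abs_mul] at u
      linarith
    have t3 : (2 * |Λ|) * (κ * |g₀₅|) ≤ (2 * Φ) * (ε * μ₁ * R * (Φ + Φ ^ 3)) :=
      mul_le_mul (by linarith) g05b (by positivity) (by positivity)
    have t4 : (|Λ| * |Λ|) * (κ * |g₅₅|) ≤ (Φ * Φ) * (ε * μ₁ * R * Φ ^ 2) :=
      mul_le_mul (mul_le_mul hΛΦ hΛΦ hΛ0 hΦpos.le) g55b (by positivity) (by positivity)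
    have t5 := mul_le_mul_of_nonneg_left t2 hκ.le
    have hΦ14 : (1 : ℝ) ≤ Φ ^ 4 := one_le_pow₀ hΦ1
    have hΦ24 : Φ ^ 2 ≤ Φ ^ 4 := pow_le_pow_right₀ hΦ1 (by norm_num)
    have a1 := mul_le_mul_of_nonneg_left hΦ14 P0
    have a2 := mul_le_mul_of_nonneg_left hΦ24 P0
    have e3 : (2 * Φ) * (ε * μ₁ * R * (Φ + Φ ^ 3)) = ε * μ₁ * R * (2 * Φ ^ 2) + ε * μ₁ * R * (2 * Φ ^ 4) := by ring
    have e4 : (Φ * Φ) * (ε * μ₁ * R * Φ ^ 2) = ε * μ₁ * R * Φ ^ 4 := by ring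
    linarith
  -- conclude with `R ≤ 2Φ²`, `Φ ≥ 1`
  have hΦ46 : Φ ^ 4 ≤ Φ ^ 6 := pow_le_pow_right₀ hΦ1 (by norm_num)
  have hΦ36 : Φ ^ 3 ≤ Φ ^ 6 := pow_le_pow_right₀ hΦ1 (by norm_num)
  have hΦ56 : Φ ^ 5 ≤ Φ ^ 6 := pow_le_pow_right₀ hΦ1 (by norm_num)
  have base : 0 ≤ ε * μ₁ := by positivity
  have nn6 : 0 ≤ ε * μ₁ * Φ ^ 6 := by positivity
  have k55 : ε * μ₁ * R * Φ ^ 2 ≤ 12 * Φ ^ 6 * ε * μ₁ := by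
    have s : ε * μ₁ * R * Φ ^ 2 ≤ ε * μ₁ * (2 * Φ ^ 2) * Φ ^ 2 :=
      mul_le_mul_of_nonneg_right (mul_le_mul_of_nonneg_left hRΦ base) (by positivity)
    have s2 : ε * μ₁ * (2 * Φ ^ 2) * Φ ^ 2 = (ε * μ₁) * (2 * Φ ^ 4) := by ring
    have s3 := mul_le_mul_of_nonneg_left hΦ46 base
    linarith
  have k05 : ε * μ₁ * R * (Φ + Φ ^ 3) ≤ 12 * Φ ^ 6 * ε * μ₁ := by
    have s : ε * μ₁ * R * (Φ + Φ ^ 3) ≤ ε * μ₁ * (2 * Φ ^ 2) * (Φ + Φ ^ 3) :=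
      mul_le_mul_of_nonneg_right (mul_le_mul_of_nonneg_left hRΦ base) (by positivity)
    have s2 : ε * μ₁ * (2 * Φ ^ 2) * (Φ + Φ ^ 3) = (ε * μ₁) * (2 * Φ ^ 3) + (ε * μ₁) * (2 * Φ ^ 5) := by ring
    have s3 := mul_le_mul_of_nonneg_left hΦ36 base
    have s4 := mul_le_mul_of_nonneg_left hΦ56 base
    linarith
  have k00 : ε * μ₁ * R * (6 * Φ ^ 4) ≤ 12 * Φ ^ 6 * ε * μ₁ := by
    have s : ε * μ₁ * R * (6 * Φ ^ 4) ≤ ε * μ₁ * (2 * Φ ^ 2) * (6 * Φ ^ 4) :=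
      mul_le_mul_of_nonneg_right (mul_le_mul_of_nonneg_left hRΦ base) (by positivity)
    have s2 : ε * μ₁ * (2 * Φ ^ 2) * (6 * Φ ^ 4) = 12 * Φ ^ 6 * ε * μ₁ := by ring
    linarith
  exact ⟨le_trans g55b k55, le_trans g05b k05, le_trans g00b k00⟩

/-! ## 2. The same degree-1 member alive again: Möbius core -/

/-- **SAME MEMBER TWICE.**  `(0,4)` alive at the first cluster (`κ₁μ₁ ≤ |g₀₄|`, all entries `≤ μ₁`) and alive again at a later scale (the two
consequences «vs `(0,1)`» and «vs `(5,4)`», weights stripped) force `κeκ₁²μ₁² ≤ |Λ|·(κe + |Λ|)·|D|` for `D = g₀₁g₅₄ − g₀₄g₅₁`, once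
`|Λ'| > e'/κ + 1/κ₁ + 1` — so `D` cannot be small.  (Mirror member `(5,1)`: the same lemma with `0 ↔ 1`, `5 ↔ 4`, `Λ ↔ Λ'`, `e ↔ e'`.) [this work] -/
theorem mixThree_core_same {κ₁ κ μ₁ e e' Λ Λ' g₀₁ g₀₄ g₅₁ g₅₄ : ℝ} (hκ₁ : 0 < κ₁) (hκ : 0 < κ) (hμ₁ : 0 < μ₁) (he : 0 < e)
    (h04 : κ₁ * μ₁ ≤ |g₀₄|) (h01 : |g₀₁| ≤ μ₁)
    (hv01 : κ * |(g₀₁ + Λ * g₅₁) + Λ' * (g₀₄ + Λ * g₅₄)| ≤ e' * |g₀₄ + Λ * g₅₄|)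
    (hv54 : κ * (e * |g₅₄|) ≤ |g₀₄ + Λ * g₅₄|)
    (hΛ' : 1 / κ * e' + (1 / κ₁ + 1) < |Λ'|) :
    κ * e * κ₁ ^ 2 * μ₁ ^ 2 ≤ |Λ| * (κ * e + |Λ|) * |g₀₁ * g₅₄ - g₀₄ * g₅₁| := by
  set X := g₀₄ + Λ * g₅₄ with hXdef
  set A := g₀₁ + Λ * g₅₁ with hAdef
  set D := g₀₁ * g₅₄ - g₀₄ * g₅₁ with hDdef
  have hX0 : 0 ≤ |X| := abs_nonneg _
  have hΛ0 : 0 ≤ |Λ| := abs_nonneg _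
  -- (1) `|X|(κ|Λ'| − e') ≤ κ|A|`
  have h1 : |X| * (κ * |Λ'| - e') ≤ κ * |A| := by
    have t : |Λ'| * |X| - |A| ≤ |A + Λ' * X| := by
      have := abs_mul_sub_abs_le_abs_add_mul A Λ' X
      linarith
    nlinarith
  -- (2) Möbius: `A g₀₄ − X g₀₁ = −Λ D`
  have h2 : |A| * |g₀₄| ≤ |X| * |g₀₁| + |Λ| * |D| := by
    have eq : A * g₀₄ = X * g₀₁ + -(Λ * D) := by rw [hAdef, hXdef, hDdef]; ring
    have t := abs_add_le (X * g₀₁) (-(Λ * D))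
    rw [← eq, abs_mul, abs_mul, abs_neg, abs_mul] at t
    exact t
  -- (3) `κ|Λ'| − e' > κ/κ₁ + κ`, multiplied out: `κ₁(κ|Λ'| − e') > κ + κκ₁`
  have i1 : κ * (1 / κ) = 1 := mul_one_div_cancel hκ.ne'
  have i2 : κ₁ * (1 / κ₁) = 1 := mul_one_div_cancel hκ₁.ne'
  have h3 : κ + κ * κ₁ < κ₁ * (κ * |Λ'| - e') := by
    have t := mul_lt_mul_of_pos_left hΛ' (mul_pos hκ hκ₁)
    have eq : κ * κ₁ * (1 / κ * e' + (1 / κ₁ + 1)) = κ₁ * e' + κ + κ * κ₁ := by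
      linear_combination (κ₁ * e') * i1 + κ * i2
    rw [eq] at t
    linarith
  -- (4) `|X| κ₁ μ₁ ≤ |Λ||D|`
  have h4 : |X| * (κ₁ * μ₁) ≤ |Λ| * |D| := by
    -- `|X|(κ + κκ₁)μ₁ ≤ |X| κ₁(κ|Λ'| − e') μ₁ ≤ |X|(κ|Λ'| − e')|g₀₄| ≤ κ|A||g₀₄| ≤ κ(|X|μ₁ + |Λ||D|)`
    have s1 : |X| * ((κ + κ * κ₁) * μ₁) ≤ |X| * (κ₁ * (κ * |Λ'| - e') * μ₁) :=
      mul_le_mul_of_nonneg_left (mul_le_mul_of_nonneg_right h3.le hμ₁.le) hX0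
    have hpos : 0 ≤ κ * |Λ'| - e' := by nlinarith
    have s2 : |X| * (κ * |Λ'| - e') * (κ₁ * μ₁) ≤ |X| * (κ * |Λ'| - e') * |g₀₄| :=
      mul_le_mul_of_nonneg_left h04 (mul_nonneg hX0 hpos)
    have s3 : |X| * (κ * |Λ'| - e') * |g₀₄| ≤ κ * |A| * |g₀₄| := mul_le_mul_of_nonneg_right h1 (abs_nonneg _)
    have s4 : κ * |A| * |g₀₄| ≤ κ * (|X| * |g₀₁| + |Λ| * |D|) := by nlinarith
    have s5 : κ * (|X| * |g₀₁|) ≤ κ * (|X| * μ₁) := mul_le_mul_of_nonneg_left (mul_le_mul_of_nonneg_left h01 hX0) hκ.le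
    nlinarith
  -- (5) `κ e κ₁ μ₁ ≤ |X|(κe + |Λ|)`
  have h5 : κ * e * (κ₁ * μ₁) ≤ |X| * (κ * e + |Λ|) := by
    have t : |g₀₄| ≤ |X| + |Λ| * |g₅₄| := by
      have := abs_sub_abs_le_abs_sub g₀₄ X
      rw [show g₀₄ - X = -(Λ * g₅₄) by rw [hXdef]; ring, abs_neg, abs_mul] at this
      linarith
    have t2 : |Λ| * (κ * (e * |g₅₄|)) ≤ |Λ| * |X| := mul_le_mul_of_nonneg_left hv54 hΛ0
    have t3 : κ * e * (κ₁ * μ₁) ≤ κ * e * (|X| + |Λ| * |g₅₄|) := mul_le_mul_of_nonneg_left (le_trans h04 t) (mul_pos hκ he).le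
    have e1 : κ * e * (|X| + |Λ| * |g₅₄|) = κ * e * |X| + |Λ| * (κ * (e * |g₅₄|)) := by ring
    have e2 : |X| * (κ * e + |Λ|) = κ * e * |X| + |Λ| * |X| := by ring
    linarith
  -- (6) combine
  calc κ * e * κ₁ ^ 2 * μ₁ ^ 2 = (κ * e * (κ₁ * μ₁)) * (κ₁ * μ₁) := by ring
    _ ≤ (|X| * (κ * e + |Λ|)) * (κ₁ * μ₁) := mul_le_mul_of_nonneg_right h5 (by positivity)
    _ = (κ * e + |Λ|) * (|X| * (κ₁ * μ₁)) := by ring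
    _ ≤ (κ * e + |Λ|) * (|Λ| * |D|) := mul_le_mul_of_nonneg_left h4 (by positivity)
    _ = |Λ| * (κ * e + |Λ|) * |D| := by ring

/-! ## 3. The other degree-1 member alive at both later scales: two-scale Möbius core -/

/-- **THE OTHER MEMBER AT BOTH LATER SCALES.**  `(0,4)` alive at the first cluster and `(5,1)` alive at the scales `S₂ < S₃` (consequences «vs
`(0,1)`, `(5,4)`, `(0,4)`», weights stripped), with `Λ₃ − Λ₂ = e₂Λ_L`, `e₃ = e₂e_L` (`L = S₃ − S₂`) and `|Λ_L| > e_L/κ₃ + 1/κ₂ + 1`, force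
`κ₁²κ₂κ₃μ₁²·e₂e'₂e'₃ < |Λ'₃ − Λ'₂|·|D|·(e₂+|Λ₂|)(e₃+|Λ₃|)`.  (Mirror: relabel.) [this work] -/
theorem mixThree_core_cross {κ₁ κ₂ κ₃ μ₁ e₂ e₂' e₃ e₃' eL Λ₂ Λ₂' Λ₃ Λ₃' ΛL g₀₁ g₀₄ g₅₁ g₅₄ : ℝ}
    (hκ₁ : 0 < κ₁) (hκ₂ : 0 < κ₂) (hκ₃ : 0 < κ₃) (hμ₁ : 0 < μ₁) (he₂ : 0 < e₂) (he₂' : 0 < e₂') (he₃ : 0 < e₃) (he₃' : 0 < e₃')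
    (h04 : κ₁ * μ₁ ≤ |g₀₄|)
    (hv01₂ : κ₂ * |(g₀₁ + Λ₂' * g₀₄) + Λ₂ * (g₅₁ + Λ₂' * g₅₄)| ≤ e₂ * |g₅₁ + Λ₂' * g₅₄|)
    (hv54₂ : κ₂ * (e₂' * |g₅₄|) ≤ |g₅₁ + Λ₂' * g₅₄|)
    (hv04₂ : κ₂ * (e₂' * |g₀₄ + Λ₂ * g₅₄|) ≤ e₂ * |g₅₁ + Λ₂' * g₅₄|)
    (hv01₃ : κ₃ * |(g₀₁ + Λ₃' * g₀₄) + Λ₃ * (g₅₁ + Λ₃' * g₅₄)| ≤ e₃ * |g₅₁ + Λ₃' * g₅₄|)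
    (hv54₃ : κ₃ * (e₃' * |g₅₄|) ≤ |g₅₁ + Λ₃' * g₅₄|)
    (hv04₃ : κ₃ * (e₃' * |g₀₄ + Λ₃ * g₅₄|) ≤ e₃ * |g₅₁ + Λ₃' * g₅₄|)
    (hshift : Λ₃ - Λ₂ = e₂ * ΛL) (he₃L : e₃ = e₂ * eL)
    (hΛL : 1 / κ₃ * eL + (1 / κ₂ + 1) < |ΛL|) :
    κ₁ ^ 2 * κ₂ * κ₃ * μ₁ ^ 2 * (e₂ * (e₂' * e₃'))
      < |Λ₃' - Λ₂'| * |g₀₁ * g₅₄ - g₀₄ * g₅₁| * ((e₂ + |Λ₂|) * (e₃ + |Λ₃|)) := by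
  set Y₂ := g₅₁ + Λ₂' * g₅₄ with hY₂
  set Y₃ := g₅₁ + Λ₃' * g₅₄ with hY₃
  set A₂ := g₀₁ + Λ₂' * g₀₄ with hA₂
  set A₃ := g₀₁ + Λ₃' * g₀₄ with hA₃
  set D := g₀₁ * g₅₄ - g₀₄ * g₅₁ with hDdef
  have hY₂0 : 0 ≤ |Y₂| := abs_nonneg _
  have hY₃0 : 0 ≤ |Y₃| := abs_nonneg _
  -- lower bounds `κᵢκ₁eᵢ'μ₁ ≤ (eᵢ + |Λᵢ|)|Yᵢ|`
  have low : ∀ {κ e e' Λ Y : ℝ}, 0 < κ → 0 < e' → κ * (e' * |g₅₄|) ≤ |Y| → κ * (e' * |g₀₄ + Λ * g₅₄|) ≤ e * |Y| →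
      κ * κ₁ * e' * μ₁ ≤ (e + |Λ|) * |Y| := by
    intro κ e e' Λ Y hκ he' h54 h04'
    have t : |g₀₄| ≤ |g₀₄ + Λ * g₅₄| + |Λ| * |g₅₄| := by
      have := abs_sub_abs_le_abs_sub g₀₄ (g₀₄ + Λ * g₅₄)
      rw [show g₀₄ - (g₀₄ + Λ * g₅₄) = -(Λ * g₅₄) by ring, abs_neg, abs_mul] at this
      linarith
    have t1 : κ * e' * (κ₁ * μ₁) ≤ κ * e' * (|g₀₄ + Λ * g₅₄| + |Λ| * |g₅₄|) :=
      mul_le_mul_of_nonneg_left (le_trans h04 t) (mul_pos hκ he').le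
    have t2 : |Λ| * (κ * (e' * |g₅₄|)) ≤ |Λ| * |Y| := mul_le_mul_of_nonneg_left h54 (abs_nonneg _)
    have e1 : κ * e' * (|g₀₄ + Λ * g₅₄| + |Λ| * |g₅₄|) = κ * (e' * |g₀₄ + Λ * g₅₄|) + |Λ| * (κ * (e' * |g₅₄|)) := by ring
    have e2 : (e + |Λ|) * |Y| = e * |Y| + |Λ| * |Y| := by ring
    have e0 : κ * κ₁ * e' * μ₁ = κ * e' * (κ₁ * μ₁) := by ring
    linarith
  have l₂ : κ₂ * κ₁ * e₂' * μ₁ ≤ (e₂ + |Λ₂|) * |Y₂| := low hκ₂ he₂' hv54₂ hv04₂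
  have l₃ : κ₃ * κ₁ * e₃' * μ₁ ≤ (e₃ + |Λ₃|) * |Y₃| := low hκ₃ he₃' hv54₃ hv04₃
  have hY₂pos : 0 < |Y₂| := by
    have : 0 < (e₂ + |Λ₂|) * |Y₂| := lt_of_lt_of_le (by positivity) l₂
    rcases hY₂0.lt_or_eq with h | h
    · exact h
    · rw [← h, mul_zero] at this; exact absurd this (lt_irrefl _)
  have hY₃pos : 0 < |Y₃| := by
    have : 0 < (e₃ + |Λ₃|) * |Y₃| := lt_of_lt_of_le (by positivity) l₃
    rcases hY₃0.lt_or_eq with h | h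
    · exact h
    · rw [← h, mul_zero] at this; exact absurd this (lt_irrefl _)
  -- the two-scale identity
  have eq : (Λ₃ - Λ₂) * (Y₂ * Y₃) = (A₃ + Λ₃ * Y₃) * Y₂ - (A₂ + Λ₂ * Y₂) * Y₃ + (Λ₃' - Λ₂') * D := by
    rw [hY₂, hY₃, hA₂, hA₃, hDdef]; ring
  have h1 : |Λ₃ - Λ₂| * (|Y₂| * |Y₃|) ≤ |A₃ + Λ₃ * Y₃| * |Y₂| + |A₂ + Λ₂ * Y₂| * |Y₃| + |Λ₃' - Λ₂'| * |D| := by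
    have t0 : |(Λ₃ - Λ₂) * (Y₂ * Y₃)| = |Λ₃ - Λ₂| * (|Y₂| * |Y₃|) := by rw [abs_mul, abs_mul]
    have t1 := abs_add_le ((A₃ + Λ₃ * Y₃) * Y₂ - (A₂ + Λ₂ * Y₂) * Y₃) ((Λ₃' - Λ₂') * D)
    have t2 := abs_sub ((A₃ + Λ₃ * Y₃) * Y₂) ((A₂ + Λ₂ * Y₂) * Y₃)
    rw [← eq] at t1
    simp only [abs_mul] at t1 t2
    linarith
  -- multiply by `κ₂κ₃` and use the «vs (0,1)» bounds
  have h2 : κ₂ * κ₃ * |Λ₃ - Λ₂| * (|Y₂| * |Y₃|) ≤ (κ₂ * e₃ + κ₃ * e₂) * (|Y₂| * |Y₃|) + κ₂ * κ₃ * (|Λ₃' - Λ₂'| * |D|) := by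
    have s := mul_le_mul_of_nonneg_left h1 (mul_pos hκ₂ hκ₃).le
    have s3 : κ₂ * (κ₃ * |A₃ + Λ₃ * Y₃|) * |Y₂| ≤ κ₂ * (e₃ * |Y₃|) * |Y₂| :=
      mul_le_mul_of_nonneg_right (mul_le_mul_of_nonneg_left hv01₃ hκ₂.le) hY₂0
    have s2 : κ₃ * (κ₂ * |A₂ + Λ₂ * Y₂|) * |Y₃| ≤ κ₃ * (e₂ * |Y₂|) * |Y₃| :=
      mul_le_mul_of_nonneg_right (mul_le_mul_of_nonneg_left hv01₂ hκ₃.le) hY₃0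
    nlinarith
  -- `|Λ₃ − Λ₂| = e₂|Λ_L|`, `e₃ = e₂ e_L`, and `κ₂κ₃|Λ_L| > κ₂e_L + κ₃ + κ₂κ₃`
  have i2 : κ₂ * (1 / κ₂) = 1 := mul_one_div_cancel hκ₂.ne'
  have i3 : κ₃ * (1 / κ₃) = 1 := mul_one_div_cancel hκ₃.ne'
  have h3 : κ₂ * eL + κ₃ + κ₂ * κ₃ < κ₂ * κ₃ * |ΛL| := by
    have t := mul_lt_mul_of_pos_left hΛL (mul_pos hκ₂ hκ₃)
    have e1 : κ₂ * κ₃ * (1 / κ₃ * eL + (1 / κ₂ + 1)) = κ₂ * eL + κ₃ + κ₂ * κ₃ := by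
      linear_combination (κ₂ * eL) * i3 + κ₃ * i2
    rw [e1] at t; exact t
  have hΛ32 : |Λ₃ - Λ₂| = e₂ * |ΛL| := by rw [hshift, abs_mul, abs_of_pos he₂]
  -- `κ₂κ₃ e₂ |Y₂||Y₃| < κ₂κ₃ |Λ₃'−Λ₂'||D|`
  have hP : 0 < |Y₂| * |Y₃| := mul_pos hY₂pos hY₃pos
  have h4 : κ₂ * κ₃ * (e₂ * (|Y₂| * |Y₃|)) < κ₂ * κ₃ * (|Λ₃' - Λ₂'| * |D|) := by
    have s := mul_lt_mul_of_pos_right h3 (mul_pos he₂ hP)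
    rw [hΛ32, he₃L] at h2
    linarith
  have h5 : e₂ * (|Y₂| * |Y₃|) < |Λ₃' - Λ₂'| * |D| := lt_of_mul_lt_mul_left h4 (mul_pos hκ₂ hκ₃).le
  -- combine with the lower bounds
  have h6 : (κ₂ * κ₁ * e₂' * μ₁) * (κ₃ * κ₁ * e₃' * μ₁) ≤ ((e₂ + |Λ₂|) * |Y₂|) * ((e₃ + |Λ₃|) * |Y₃|) :=
    mul_le_mul l₂ l₃ (by positivity) (le_trans (by positivity) l₂)
  have hE : 0 < (e₂ + |Λ₂|) * (e₃ + |Λ₃|) := by positivity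
  calc κ₁ ^ 2 * κ₂ * κ₃ * μ₁ ^ 2 * (e₂ * (e₂' * e₃'))
      = e₂ * ((κ₂ * κ₁ * e₂' * μ₁) * (κ₃ * κ₁ * e₃' * μ₁)) := by ring
    _ ≤ e₂ * (((e₂ + |Λ₂|) * |Y₂|) * ((e₃ + |Λ₃|) * |Y₃|)) := mul_le_mul_of_nonneg_left h6 he₂.le
    _ = (e₂ * (|Y₂| * |Y₃|)) * ((e₂ + |Λ₂|) * (e₃ + |Λ₃|)) := by ring
    _ < (|Λ₃' - Λ₂'| * |D|) * ((e₂ + |Λ₂|) * (e₃ + |Λ₃|)) := mul_lt_mul_of_pos_right h5 hE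
    _ = |Λ₃' - Λ₂'| * |D| * ((e₂ + |Λ₂|) * (e₃ + |Λ₃|)) := by ring

end Summit.ValiantsHypothesis.ValiantsHypothesis.Theorems.LacunarySymmetroidMatrixDescartes.WallBubbling
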